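import Summits.Langlands.Langlands.Theorems.IrreducibilityBySelfDualityReciprocityUpToIrreducibilityRankOne
import HarnessLib

/-!
# `ReciprocityUpToIrreducibility` (stmt-Langlands-14328) — negative knowledge II:
# the trivial automorphic character pins the Weil–Deligne representation at `v ∣ ℓ`

Sorry-free, pure theorems, axioms `propext`/`Classical.choice`/`Quot.sound` (cdisprove cycle 1, seat
refuter-cdisprove-stmt-Langlands-14328-0).  Rank-one bookkeeping in the summit's own vocabulary
(`Summit.Langlands.LocalGlobalCompatibleAt`, `SatakeFrobCompatibleAt`), used by
`PinnedFontaineDatumUndecided`: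

* `exists_trivial_cuspidal` — the trivial character of `GL₁(𝔸_K)` as a cuspidal L-algebraic
  Borel–Jacquet datum `π_𝟙 = ℂ·1/⊥` with Satake parameter `{1}` at almost every place (the tree's
  rank-one dictionary `exists_automorphicRepData_detTwist_glOne`, `hasSatakeParamAt_detTwist_glOne`).
* `eq_one_of_satakeFrobCompatible_trivial` — a rank-one `ρ : Γ_K → GL₁(ℚ̄_ℓ)` Satake–Frobenius
  compatible a.e. with `π_𝟙` IS `1` (Chebotarev density, `absoluteGaloisGroup.frobenius_dense`, proved in
  tree, + continuity).
* `isWeilDeligneOf_trivial_of_localGlobalCompatibleAt` — for `π_𝟙`, local–global compatibility at a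
  place `v ∣ ℓ` with ANY `ρ` (and ANY reciprocity datum `Rec`) forces the PINNED `p`-adic Hodge datum to
  attach the TRIVIAL Weil–Deligne representation to `ρ|_{Γ_{K_v}}`: the local component of `π_𝟙` is the
  trivial character (irreducibility of `π_v`, `W = ℂ·1`), `rec_v` of it is `(1 ∘ artin, N = 0)` (`gl_one`
  of the local Langlands datum), rank one kills the nilpotent part of the Frobenius-semisimplification
  (`eq_zero_of_isNilpotent_fin_one`), and transport along `ι` pins `r` (`wd_ext`).
[folklore]
-/

noncomputable section

set_option linter.dupNamespace false -- project-wide option; `Summit.Langlands.Langlands` is the mandated namespace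

open scoped MatrixGroups NumberField Classical
open Field Filter IsDedekindDomain
open Literature.NumberTheory.Automorphic Literature.NumberTheory.GaloisRepresentations
open Literature.NumberTheory.PAdicHodge
open Summit.Langlands

namespace Summit.Langlands.Langlands.Theorems.ReciprocityUpToIrreducibility.Negative

/-- Two Weil–Deligne representations with the same `ρ` and the same `N` are equal. [folklore] -/
theorem wd_ext {F : Type} [Field F] [ValuativeRel F] [TopologicalSpace F] [IsNonarchimedeanLocalField F]
    {C : Type*} [Field C] [CharZero C] {V : Type*} [AddCommGroup V] [Module C V]
    {r r' : WeilDeligneRep F C V} (hρ : r.ρ = r'.ρ) (hN : r.N = r'.N) : r = r' := by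
  cases r; cases r'; cases hρ; cases hN; rfl

/-- A nilpotent endomorphism of a line is zero. [folklore] -/
theorem eq_zero_of_isNilpotent_fin_one {C : Type*} [Field C] (n : Module.End C (Fin 1 → C))
    (hn : IsNilpotent n) : n = 0 := by
  set a : C := n (fun _ => 1) 0 with ha
  have hscalar : n = a • (1 : Module.End C (Fin 1 → C)) := by
    apply LinearMap.ext
    intro v
    funext i
    have hv : v = v 0 • (fun _ : Fin 1 => (1 : C)) := by
      funext j
      rw [Subsingleton.elim j 0, Pi.smul_apply, smul_eq_mul, mul_one]
    rw [Subsingleton.elim i 0, hv, map_smul]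
    simp [ha, mul_comm]
  obtain ⟨k, hk⟩ := hn
  have hak : a ^ k = 0 := by
    have h := congrArg (fun f : Module.End C (Fin 1 → C) => f (fun _ => 1) 0) hk
    simp only [hscalar, smul_pow, one_pow, LinearMap.smul_apply, Module.End.one_apply,
      LinearMap.zero_apply, Pi.smul_apply, Pi.zero_apply, smul_eq_mul, mul_one] at h
    exact h
  have ha0 : a = 0 := IsNilpotent.eq_zero ⟨k, hak⟩
  rw [hscalar, ha0, zero_smul]

variable {K : Type} [Field K] [NumberField K] {ℓ : ℕ} [Fact ℓ.Prime]

/-- **Local unpacking at `v ∣ ℓ`.** For the trivial automorphic character `π = ℂ·1/⊥` of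
`GL₁(𝔸_K)` (`W = ℂ · (1 ∘ det)`, `W' = ⊥`), local–global compatibility at `v` with ANY `ρ` forces the
pinned datum to attach the TRIVIAL Weil–Deligne representation to `ρ|_{Γ_{K_v}}`: the local
component of `π` at `v` is the trivial character (irreducibility of `π_v` + `W = ℂ·1`), `rec_v` of it
is `(1 ∘ artin, 0)` (`gl_one`), its Frobenius-semisimple class pins `rℂ` (rank one: nilpotents
vanish), and transport along `ι` pins `r`. [folklore] -/
theorem isWeilDeligneOf_trivial_of_localGlobalCompatibleAt
    {hcpt : isCompact_glFiniteIntegralLevel 1 K}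
    {π : AutomorphicRepData (AutomorphyDatum.gl 1 K hcpt)}
    (hW : π.W = Submodule.span ℂ {fun g : (AdelicGroupData.gl 1 K).Adelic =>
      (detTwist 1 (1 : HeckeCharacter K) g : ℂ)})
    (hW' : π.W' = ⊥) (Rec : ReciprocityData K) (ι : PadicAlgCl ℓ ≃+* ℂ)
    (ρ : FramedGaloisRep K (PadicAlgCl ℓ) 1) (v : HeightOneSpectrum (𝓞 K))
    (h : LocalGlobalCompatibleAt Rec ι π ρ v) (hv : ((ℓ : ℕ) : 𝓞 K) ∈ v.asIdeal) :
    (fontainePstAdicCompletion v ℓ hv).IsWeilDeligneOf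
      (ρ.toLocal v) (WeilDeligneRep.trivial (PadicAlgCl ℓ) (Fin 1 → PadicAlgCl ℓ)) := by
  obtain ⟨πv, r, rℂ, hloc, -, hpst, htr, hcls⟩ := h
  -- (1) the local component is the trivial character
  have htriv : ∀ (g : GL (Fin 1) (v.adicCompletion K)) (x : πv.V), πv.ρ g x = x := by
    obtain ⟨f, hfW, hfW', hf⟩ := hloc
    have hd1 : ∀ h : (AdelicGroupData.gl 1 K).Adelic,
        ((detTwist 1 (1 : HeckeCharacter K) h : ℂˣ) : ℂ) = 1 := fun h => by
      rw [detTwist_apply, HeckeCharacter.one_apply, Units.val_one]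
    have hfix : ∀ (g : GL (Fin 1) (v.adicCompletion K)) (x : πv.V),
        rightTranslation (AdelicGroupData.gl 1 K) (GLn.ofLocal 1 K v g) (f x) = f x := by
      intro g x
      have hx : f x ∈ π.W := hfW (LinearMap.mem_range_self f x)
      rw [hW, Submodule.mem_span_singleton] at hx
      obtain ⟨a, ha⟩ := hx
      rw [← ha, map_smul, rightTranslation_detTwist_glOne, hd1, one_smul]
    have hinv : ∀ g x, f (πv.ρ g x) = f x := by
      intro g x
      have h0 := hf g x
      rw [hW', Submodule.mem_bot, hfix, sub_eq_zero] at h0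
      exact h0
    let Φ : Representation.IntertwiningMap πv.ρ
        (Representation.trivial ℂ (GL (Fin 1) (v.adicCompletion K))
          ((AdelicGroupData.gl 1 K).Adelic → ℂ)) :=
      ⟨f, fun g => LinearMap.ext fun x => by
        simp only [LinearMap.coe_comp, Function.comp_apply, Representation.trivial_apply, hinv g x]⟩
    have hΦ : ∀ y, Φ y = f y := fun _ => rfl
    rcases Representation.IsIrreducible.injective_or_eq_zero Φ with hinj | hzero
    · intro g x
      exact hinj (show Φ (πv.ρ g x) = Φ x by rw [hΦ, hΦ, hinv g x])
    · exfalso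
      apply hfW'
      have hf0 : f = 0 := by
        apply LinearMap.ext
        intro y
        rw [← hΦ, hzero]
        rfl
      rw [hf0, LinearMap.range_zero]
      exact bot_le
  -- (2) local Langlands for `GL₁`: `rec(π_v) ≅ (1 ∘ artin, N = 0)`
  set L := Rec.llc v with hL
  have hact : ∀ (g : GL (Fin 1) (v.adicCompletion K)) (w : πv.V),
      πv.ρ g w = (((1 : QuasiChar (v.adicCompletion K)) (Matrix.GeneralLinearGroup.det g) : ℂˣ) :
        ℂ) • w := by
    intro g w
    rw [htriv g w]
    simp
  have hgl := L.isLocalLanglands.gl_one 1 πv hact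
  -- (3) the Frobenius-semisimple class of `rℂ` is `rec(π_v)`
  obtain ⟨r', hF, hq⟩ := hcls
  have hr'c : r'.IsEquivalent ((L.recGL 1 (IrrClass.mk πv)).out).1 :=
    Quotient.exact (hq.trans (Quotient.out_eq _).symm)
  obtain ⟨e⟩ := hr'c.trans hgl
  have hT : ∀ w, (WeilDeligneRep.ofQuasiChar L.hns L.artin (1 : QuasiChar (v.adicCompletion K))).ρ w
      = LinearMap.id := fun w => LinearMap.ext fun z => by simp
  have heinj : Function.Injective e.toLinearMap := e.toLinearEquiv.injective
  have hr'ρ : ∀ w, r'.ρ w = LinearMap.id := by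
    intro w
    apply LinearMap.ext
    intro x
    apply heinj
    have h1 := congrArg (fun f => f x) (e.toRepEquiv.isIntertwining' w)
    simpa [hT] using h1
  have hr'N : r'.N = 0 := by
    apply LinearMap.ext
    intro x
    apply heinj
    have h1 := congrArg (fun f => f x) e.comm_N
    simpa using h1
  -- (4) rank one: `rℂ` itself is trivial
  obtain ⟨hNN, -, hss⟩ := hF
  have hrℂN : rℂ.N = 0 := hNN ▸ hr'N
  have hrℂρ : ∀ w, rℂ.ρ w = LinearMap.id := by
    intro w
    obtain ⟨-, nw, hnil, -, hdec⟩ := hss w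
    rw [hdec, hr'ρ w, eq_zero_of_isNilpotent_fin_one nw hnil, add_zero]
  -- (5) transport along `ι`: `r` is trivial
  have hι0 : (ι : PadicAlgCl ℓ →+* ℂ) 0 = 0 := map_zero _
  have hι1 : (ι : PadicAlgCl ℓ →+* ℂ) 1 = 1 := map_one _
  have hrρ : ∀ w, r.ρ w = LinearMap.id := by
    intro w
    have h1 := htr.1 w
    rw [hrℂρ w, LinearMap.toMatrix'_id] at h1
    have h2 : LinearMap.toMatrix' (r.ρ w) = 1 := by
      apply Matrix.map_injective (RingHom.injective (ι : PadicAlgCl ℓ →+* ℂ))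
      dsimp only
      rw [← h1, Matrix.map_one _ hι0 hι1]
    exact LinearMap.toMatrix'.injective (h2.trans LinearMap.toMatrix'_id.symm)
  have hrN : r.N = 0 := by
    have h1 := htr.2
    rw [hrℂN, map_zero] at h1
    have h2 : LinearMap.toMatrix' r.N = 0 := by
      apply Matrix.map_injective (RingHom.injective (ι : PadicAlgCl ℓ →+* ℂ))
      dsimp only
      rw [← h1, Matrix.map_zero _ hι0]
    exact LinearMap.toMatrix'.injective (h2.trans (map_zero _).symm)
  have hr : r = WeilDeligneRep.trivial (PadicAlgCl ℓ) (Fin 1 → PadicAlgCl ℓ) := by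
    refine wd_ext (MonoidHom.ext fun w => ?_) ?_
    · rw [hrρ w]; rfl
    · rw [hrN]; rfl
  rw [← hr]
  exact hpst hv

/-- **The trivial automorphic character of `GL₁(𝔸_K)` as a cuspidal L-algebraic datum with Satake
parameter `{1}` almost everywhere** (`π_𝟙 = ℂ·1/⊥`; Borel–Jacquet 4.6, rank-one dictionary in
tree). [folklore] -/
theorem exists_trivial_cuspidal (hcpt : isCompact_glFiniteIntegralLevel 1 K) :
    ∃ π : CuspidalAutomorphicRepData 1 K hcpt,
      π.1.W = Submodule.span ℂ {fun g : (AdelicGroupData.gl 1 K).Adelic =>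
        (detTwist 1 (1 : HeckeCharacter K) g : ℂ)} ∧
      π.1.W' = ⊥ ∧ π.1.IsLAlgebraic ∧
      ∀ᶠ v : HeightOneSpectrum (𝓞 K) in cofinite, π.1.HasSatakeParamAt v {1} := by
  classical
  obtain ⟨π₀, hW, hW'⟩ := exists_automorphicRepData_detTwist_glOne hcpt (1 : HeckeCharacter K)
  have hcusp : π₀.W ≤ cuspFormsGL 1 K hcpt := by
    rw [hW, Submodule.span_le]
    rintro _ rfl
    exact IsCuspFormGL.mem_cuspFormsGL
      ⟨isAutomorphicForm_detTwist_glOne hcpt 1, fun k hk hk1 => absurd hk1 (by omega)⟩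
  set π : CuspidalAutomorphicRepData 1 K hcpt := ⟨π₀, hcusp⟩ with hπdef
  have hχ : ∀ (g : (AdelicGroupData.gl 1 K).Adelic), ∀ φ ∈ π.1.W,
      rightTranslation (AdelicGroupData.gl 1 K) g φ -
        (((1 : HeckeCharacter K) (Matrix.GeneralLinearGroup.det g) : ℂˣ) : ℂ) • φ ∈ π.1.W' := by
    intro g φ hφ
    change φ ∈ π₀.W at hφ
    rw [hW, Submodule.mem_span_singleton] at hφ
    obtain ⟨c, rfl⟩ := hφ
    rw [map_smul, rightTranslation_detTwist_glOne, detTwist_apply, smul_comm, sub_self]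
    exact π.1.W'.zero_mem
  refine ⟨π, hW, hW', ?_, ?_⟩
  · have hωfin : (1 : HeckeCharacter K).IsFiniteOrder := IsOfFinOrder.one
    obtain ⟨p, q, hpq⟩ :=
      ((1 : HeckeCharacter K).isAlgebraic_iff_exists_hasInfinityType).mp hωfin.isAlgebraic
    obtain ⟨T, hT, hTa⟩ :=
      π.1.exists_hasInfinityType_of_hasInfinityType_heckeCharacter_glOne hχ hpq
    refine ⟨T, hT, fun σ w hw => ?_⟩
    have ha : w.a = -((HeckeCharacter.embExponent p q σ : ℤ) : ℂ) := by
      have hmem : w.a ∈ (T σ).map ArchWeight.a := Multiset.mem_map_of_mem _ hw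
      rw [hTa σ] at hmem
      exact Multiset.mem_singleton.mp hmem
    obtain ⟨m, hm⟩ := w.exists_int_sub
    refine ⟨-HeckeCharacter.embExponent p q σ, -HeckeCharacter.embExponent p q σ - m, ?_, ?_⟩
    · rw [ha]
      push_cast
      ring
    · have hb : w.b = w.a - m := by rw [← hm]; ring
      rw [hb, ha]
      push_cast
      ring
  · obtain ⟨𝔪, h𝔪, hω𝔪⟩ := HeckeCharacter.exists_level_glOne (1 : HeckeCharacter K)
    filter_upwards [(Ideal.finite_factors h𝔪).compl_mem_cofinite] with v hv
    have hsat := AutomorphicRepData.hasSatakeParamAt_detTwist_glOne hcpt hW hW' h𝔪 hω𝔪 v hv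
      (HeckeCharacter.valued_uniformizer (K := K) v)
    simpa using hsat

/-- **Rigidity of the trivial character (Chebotarev density).** A rank-one `ρ` which is
Satake–Frobenius compatible a.e. with an automorphic datum of Satake parameter `{1}` a.e. IS the
trivial representation. [folklore] -/
theorem eq_one_of_satakeFrobCompatible_trivial {hcpt : isCompact_glFiniteIntegralLevel 1 K}
    {π : CuspidalAutomorphicRepData 1 K hcpt}
    (hsat : ∀ᶠ v : HeightOneSpectrum (𝓞 K) in cofinite, π.1.HasSatakeParamAt v {1})
    (ι : PadicAlgCl ℓ ≃+* ℂ) (ρ : FramedGaloisRep K (PadicAlgCl ℓ) 1)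
    (hρ : ∀ᶠ v : HeightOneSpectrum (𝓞 K) in cofinite, SatakeFrobCompatibleAt ι π.1 ρ v) :
    ρ = 1 := by
  classical
  have hev : ∀ᶠ v : HeightOneSpectrum (𝓞 K) in cofinite, ∀ 𝔓 ∈ v.primesAbove,
      ∀ Φ : absoluteGaloisGroup K, IsArithFrobAt (𝓞 K) Φ 𝔓 →
        (((ρ Φ : GL (Fin 1) (PadicAlgCl ℓ)) : Matrix (Fin 1) (Fin 1) (PadicAlgCl ℓ)) 0 0) = 1 := by
    filter_upwards [hsat, hρ] with v hv1 hv
    obtain ⟨α, hα, -, hcp⟩ := hv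
    obtain rfl : α = {1} := AutomorphicRepData.hasSatakeParamAt_unique_holds π.1 hα hv1
    rw [arithFrobPolyOfSatake_one, Multiset.map_singleton, Multiset.prod_singleton, inv_one,
      map_one] at hcp
    exact (FramedGaloisRep.hasFrobCharpolyAt_iff_of_rank_one ρ v 1).mp hcp
  set S : Set (HeightOneSpectrum (𝓞 K)) := {v | ¬ ∀ 𝔓 ∈ v.primesAbove,
      ∀ Φ : absoluteGaloisGroup K, IsArithFrobAt (𝓞 K) Φ 𝔓 →
        (((ρ Φ : GL (Fin 1) (PadicAlgCl ℓ)) : Matrix (Fin 1) (Fin 1) (PadicAlgCl ℓ)) 0 0) = 1}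
    with hS
  have hSfin : S.Finite := Filter.eventually_cofinite.1 hev
  have hdense := absoluteGaloisGroup.frobenius_dense chebotarev_artinRep_holds K S hSfin
  have htrace : ∀ σ, FramedRep.trace ρ σ =
      (((ρ σ : GL (Fin 1) (PadicAlgCl ℓ)) : Matrix (Fin 1) (Fin 1) (PadicAlgCl ℓ)) 0 0) := by
    intro σ
    simp [FramedRep.trace, Matrix.trace_fin_one]
  have hclosed : IsClosed {σ : absoluteGaloisGroup K | FramedRep.trace ρ σ = 1} :=
    isClosed_eq (FramedRep.continuous_trace ρ) continuous_const
  have hsub : {σ : absoluteGaloisGroup K | ∃ v ∉ S, ∃ 𝔓 ∈ v.primesAbove, IsArithFrobAt (𝓞 K) σ 𝔓} ⊆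
      {σ | FramedRep.trace ρ σ = 1} := by
    rintro σ ⟨v, hv, 𝔓, h𝔓, hσ⟩
    simp only [hS, Set.mem_setOf_eq, not_not] at hv
    show FramedRep.trace ρ σ = 1
    rw [htrace]
    exact hv 𝔓 h𝔓 σ hσ
  have hall : ∀ σ, FramedRep.trace ρ σ = 1 := fun σ =>
    hclosed.closure_subset_iff.2 hsub (by rw [hdense.closure_eq]; exact Set.mem_univ σ)
  refine DFunLike.ext _ _ fun σ => ?_
  ext i j
  rw [Subsingleton.elim i 0, Subsingleton.elim j 0, ← htrace, hall]
  rfl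

/-- `(1 : Γ_K → GL₁).toLocal v = 1`. [folklore] -/
theorem toLocal_one (v : HeightOneSpectrum (𝓞 K)) :
    (1 : FramedGaloisRep K (PadicAlgCl ℓ) 1).toLocal v = 1 :=
  DFunLike.ext _ _ fun _ => rfl

end Summit.Langlands.Langlands.Theorems.ReciprocityUpToIrreducibility.Negative

end
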